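import Summits.HodgeConjecture.CorCM.AbelianTwoPowerSubgroupInduction
import HarnessLib

/-!
# The six ATOMS of the abelian `2`-power classification: kernel-decided subgroup models

COR-CM (cell `pub-hodgecm2`), binder seat b04 (gen 16), count-neutral claim ABELIAN-2POWER-NECESSITY,
  part IIa (atoms of order `16`; §0 = part I with decidable instances).
KERNEL ONLY: theorems; no definition, no named fact, no `sorry`.  `HC_CM` is neither used nor claimed.

An ATOM is a pair `(M, c₀)` — a small abelian `2`-group with an involution — carrying a SUBGROUP MODEL in the sense
of part I (`SubgroupInduction.exists_isPrimitive_not_isNondegenerate_of_subgroupModel`): `T₀ ⊆ M` a CM set for `c₀`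
with trivial stabiliser, balanced over the fibres of an additive `f : M → N` with `f(c₀) ≠ 0`, and a balanced CM set
`T₁` of which `T₀` is not a translate.  By part I, EVERY abelian CM field whose Galois group contains `M` as a
subgroup with `c₀ =` complex conjugation has a PRIMITIVE DEGENERATE CM type, realised by a simple degenerate CM
abelian variety.  The six atoms (all hypotheses by `decide`; models found by exhaustive search, this seat's
`scratch/atoms.py`):

| atom | `M` | `c₀` | order | balanced over |
|---|---|---|---|---|
| `44` | `ℤ/4 × ℤ/4` | `(2,0)` | 16 | `pr₁` (cyclic quartic CM subfield) |
| `422` | `ℤ/4 × (ℤ/2)²` | `(0,1,0)` | 16 | middle coordinate (imaginary quadratic subfield) |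
| `82` | `ℤ/8 × ℤ/2` | `(0,1)` | 16 | `pr₂` (imaginary quadratic subfield) |
| `22222` | `(ℤ/2)⁵` | `e₁` | 32 | `pr₁` (imaginary quadratic subfield) |
| `4222` | `ℤ/4 × (ℤ/2)³` | `(2,0,0,0)` | 32 | `pr₁` (cyclic quartic CM subfield) |
| `822` | `ℤ/8 × (ℤ/2)²` | `(4,0,0)` | 32 | `pr₁` (cyclic octic CM subfield) |

Part III shows that an abelian `2`-group with involution `c` which is neither "thin" (`c` in a cyclic subgroup of
index `≤ 2`), nor of order `≤ 8`, nor of order `16` with all squares in `{1, c}`, contains one of these six atoms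
through `c`; part IV assembles the classification.  (Gen 15's parts V/VI used ISOMORPHISM models for the Galois
types `ℤ/4 × ℤ/4`, `ℤ/4 × (ℤ/2)²`, `ℤ/8 × ℤ/2` of degree `16`; the atoms here are SUBGROUP models — different sets,
with the companion `T₁` — and apply in every degree.)

## References

* [Shimura1998] G. Shimura, *Abelian Varieties with Complex Multiplication and Modular Functions*, §6.2 Thm. 3,
  §8.1, §8.2 Prop. 26.
* [Gordon1999HodgeAVSurvey] B. B. Gordon, *A survey of the Hodge conjecture for abelian varieties*, §9.4.2, §9.4.3
  (Theorem [B.140] = Yanai 1994).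
-/

noncomputable section

open CategoryTheory CategoryTheory.Limits NumberField

namespace Summit.HodgeConjecture.CorCM.TwoPowerAtoms

open Literature.NumberTheory.ComplexMultiplication
open Literature.AlgebraicGeometry.Motives (AbelianVariety CMType)
open Literature.AlgebraicGeometry.HodgeTheory
open Literature.AlgebraicGeometry.ComplexMultiplication (IsCMTypeRealisation)
open Literature.AlgebraicGeometry.Pohlmann1968
open Summit.HodgeConjecture.CorCM.SubgroupInduction

open scoped Classical

variable {K : Type} [Field K] [NumberField K] [IsCMField K] [IsGalois ℚ K]

/-! ## §0 Part I's subgroup-model theorem with decidable instances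

Part I (`SubgroupInduction`) states the balance hypotheses with the `Decidable` instances of its own (classical)
context; kernel-decided models on concrete groups (`ZMod 4 × ZMod 4`, …) carry the computable instances.  The two
agree (`Decidable` is a subsingleton); this section transports once and for all. -/

/-- Part I's `SubgroupInduction.exists_isPrimitive_not_isNondegenerate_of_subgroupModel` for models on an additive
group with decidable equality (balance hypotheses stated with the computable instances): an injective `j : M ↪
Gal(K/ℚ)` through complex conjugation and a subgroup model `(T₀, T₁, f)` give a PRIMITIVE DEGENERATE CM type.
[cite: Gordon1999HodgeAVSurvey, §9.4.3 (Theorem [B.140])] [cite: Shimura1998, §8.1, §8.2 Prop. 26] -/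
theorem exists_isPrimitive_not_isNondegenerate_of_model (hcomm : ∀ g h : K ≃ₐ[ℚ] K, g * h = h * g)
    {M N : Type*} [AddCommGroup M] [Fintype M] [DecidableEq M] [AddCommGroup N] [DecidableEq N]
    (j : M →+ Additive (K ≃ₐ[ℚ] K)) (hj : Function.Injective j) (c₀ : M)
    (hc : Additive.toMul (j c₀) = (IsCMField.complexConj K).restrictScalars ℚ) (T₀ T₁ : Finset M)
    (hcm₀ : ∀ x : M, x ∈ T₀ ↔ c₀ + x ∉ T₀) (hcm₁ : ∀ x : M, x ∈ T₁ ↔ c₀ + x ∉ T₁)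
    (hprim : ∀ v : M, v ≠ 0 → ∃ w : M, ¬ (w ∈ T₀ ↔ v + w ∈ T₀))
    (hntr : ∀ d : M, ∃ w : M, ¬ (w ∈ T₁ ↔ d + w ∈ T₀)) (f : M →+ N) (hfc : f c₀ ≠ 0)
    (hbal₀ : ∀ x : M, (Finset.univ.filter fun h : M => f h = f x ∧ h ∈ T₀).card =
      (Finset.univ.filter fun h : M => f h = f x ∧ h ∉ T₀).card)
    (hbal₁ : ∀ x : M, (Finset.univ.filter fun h : M => f h = f x ∧ h ∈ T₁).card =
      (Finset.univ.filter fun h : M => f h = f x ∧ h ∉ T₁).card) (φ₀ : K →+* ℂ) :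
    ∃ Φ : CMType K, IsPrimitive (ℂ ≃+* ℂ) Φ.1 φ₀ ∧ ¬ IsNondegenerate Φ :=
  exists_isPrimitive_not_isNondegenerate_of_subgroupModel hcomm j hj c₀ hc T₀ T₁ hcm₀ hcm₁ hprim hntr f hfc
    (fun x => by convert hbal₀ x using 3) (fun x => by convert hbal₁ x using 3) φ₀

/-- Realisation form of `exists_isPrimitive_not_isNondegenerate_of_model`: a SIMPLE abelian variety of dimension
`[K:ℚ]/2` with complex multiplication by `K` of DEGENERATE type (part I's `exists_simple_degenerate_of_subgroupModel`,
which also records an exceptional Hodge class on a power). [cite: Shimura1998, §6.2 Thm. 3 and §8.2 Prop. 26]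
[cite: Gordon1999HodgeAVSurvey, §9.4.3 (Theorem [B.140])] -/
theorem exists_simple_degenerate_of_model (hcomm : ∀ g h : K ≃ₐ[ℚ] K, g * h = h * g)
    {M N : Type*} [AddCommGroup M] [Fintype M] [DecidableEq M] [AddCommGroup N] [DecidableEq N]
    (j : M →+ Additive (K ≃ₐ[ℚ] K)) (hj : Function.Injective j) (c₀ : M)
    (hc : Additive.toMul (j c₀) = (IsCMField.complexConj K).restrictScalars ℚ) (T₀ T₁ : Finset M)
    (hcm₀ : ∀ x : M, x ∈ T₀ ↔ c₀ + x ∉ T₀) (hcm₁ : ∀ x : M, x ∈ T₁ ↔ c₀ + x ∉ T₁)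
    (hprim : ∀ v : M, v ≠ 0 → ∃ w : M, ¬ (w ∈ T₀ ↔ v + w ∈ T₀))
    (hntr : ∀ d : M, ∃ w : M, ¬ (w ∈ T₁ ↔ d + w ∈ T₀)) (f : M →+ N) (hfc : f c₀ ≠ 0)
    (hbal₀ : ∀ x : M, (Finset.univ.filter fun h : M => f h = f x ∧ h ∈ T₀).card =
      (Finset.univ.filter fun h : M => f h = f x ∧ h ∉ T₀).card)
    (hbal₁ : ∀ x : M, (Finset.univ.filter fun h : M => f h = f x ∧ h ∈ T₁).card =
      (Finset.univ.filter fun h : M => f h = f x ∧ h ∉ T₁).card) :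
    ∃ (Φ : CMType K) (φ₀ : K →+* ℂ) (A : AbelianVariety ℂ) (ι : 𝓞 K →+* End A)
      (θ : K →+* Module.End ℂ (complexBetti A.X 1)),
      IsPrimitive (ℂ ≃+* ℂ) Φ.1 φ₀ ∧ ¬ IsNondegenerate Φ ∧ IsCMTypeRealisation Φ A ι θ ∧ A.IsSimple ∧
      A.dim = Module.finrank ℚ K / 2 := by
  obtain ⟨Φ, φ₀, A, ι, θ, h1, h2, h3, h4, h5, -⟩ := exists_simple_degenerate_of_subgroupModel hcomm j hj c₀ hc
    T₀ T₁ hcm₀ hcm₁ hprim hntr f hfc (fun x => by convert hbal₀ x using 3) (fun x => by convert hbal₁ x using 3)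
  exact ⟨Φ, φ₀, A, ι, θ, h1, h2, h3, h4, h5⟩

/-! ## Atom `44`: `ℤ/4 × ℤ/4`, `c₀ = (2,0)` -/

section Atom44

/-- Atom `44`: `ℤ/4 × ℤ/4`, `c₀ = (2,0)` — `T₀` is a CM set. [folklore] -/
theorem cm₀_44 : ∀ x : ZMod 4 × ZMod 4, x ∈ ({(0,0), (0,1), (1,1), (1,3), (2,2), (2,3), (3,0),
  (3,2)} : Finset (ZMod 4 × ZMod 4)) ↔
    (2, 0) + x ∉ ({(0,0), (0,1), (1,1), (1,3), (2,2), (2,3), (3,0), (3,2)} : Finset (ZMod 4 × ZMod 4)) := by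
  decide

/-- Atom `44`: the companion `T₁` is a CM set. [folklore] -/
theorem cm₁_44 : ∀ x : ZMod 4 × ZMod 4, x ∈ ({(0,0), (0,1), (1,0), (1,3), (2,2), (2,3), (3,1),
  (3,2)} : Finset (ZMod 4 × ZMod 4)) ↔
    (2, 0) + x ∉ ({(0,0), (0,1), (1,0), (1,3), (2,2), (2,3), (3,1), (3,2)} : Finset (ZMod 4 × ZMod 4)) := by
  decide

/-- Atom `44`: `T₀` has trivial stabiliser. [folklore] -/
theorem prim_44 : ∀ v : ZMod 4 × ZMod 4, v ≠ 0 → ∃ w : ZMod 4 × ZMod 4,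
    ¬ (w ∈ ({(0,0), (0,1), (1,1), (1,3), (2,2), (2,3), (3,0), (3,2)} : Finset (ZMod 4 × ZMod 4)) ↔ v + w ∈ ({(0,0),
      (0,1), (1,1), (1,3), (2,2), (2,3), (3,0), (3,2)} : Finset (ZMod 4 × ZMod 4))) := by
  decide

/-- Atom `44`: `T₀` is not a translate of `T₁`. [folklore] -/
theorem ntr_44 : ∀ d : ZMod 4 × ZMod 4, ∃ w : ZMod 4 × ZMod 4,
    ¬ (w ∈ ({(0,0), (0,1), (1,0), (1,3), (2,2), (2,3), (3,1), (3,2)} : Finset (ZMod 4 × ZMod 4)) ↔ d + w ∈ ({(0,0),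
      (0,1), (1,1), (1,3), (2,2), (2,3), (3,0), (3,2)} : Finset (ZMod 4 × ZMod 4))) := by
  decide

/-- Atom `44`: `T₀` is balanced `(2,2,2,2)` over the fibres of the first projection (kernel `0 × ℤ/4`,
  a cyclic quartic CM subfield). [folklore] -/
theorem bal₀_44 : ∀ x : ZMod 4 × ZMod 4,
    (Finset.univ.filter fun h : ZMod 4 × ZMod 4 => (AddMonoidHom.fst (ZMod 4) (ZMod 4)) h = (AddMonoidHom.fst (ZMod 4) (ZMod 4)) x ∧
      h ∈ ({(0,0), (0,1), (1,1), (1,3), (2,2), (2,3), (3,0), (3,2)} : Finset (ZMod 4 × ZMod 4))).card =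
    (Finset.univ.filter fun h : ZMod 4 × ZMod 4 => (AddMonoidHom.fst (ZMod 4) (ZMod 4)) h = (AddMonoidHom.fst (ZMod 4) (ZMod 4)) x ∧
      h ∉ ({(0,0), (0,1), (1,1), (1,3), (2,2), (2,3), (3,0), (3,2)} : Finset (ZMod 4 × ZMod 4))).card := by
  decide

/-- Atom `44`: `T₁` is balanced over the same fibres. [folklore] -/
theorem bal₁_44 : ∀ x : ZMod 4 × ZMod 4,
    (Finset.univ.filter fun h : ZMod 4 × ZMod 4 => (AddMonoidHom.fst (ZMod 4) (ZMod 4)) h = (AddMonoidHom.fst (ZMod 4) (ZMod 4)) x ∧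
      h ∈ ({(0,0), (0,1), (1,0), (1,3), (2,2), (2,3), (3,1), (3,2)} : Finset (ZMod 4 × ZMod 4))).card =
    (Finset.univ.filter fun h : ZMod 4 × ZMod 4 => (AddMonoidHom.fst (ZMod 4) (ZMod 4)) h = (AddMonoidHom.fst (ZMod 4) (ZMod 4)) x ∧
      h ∉ ({(0,0), (0,1), (1,0), (1,3), (2,2), (2,3), (3,1), (3,2)} : Finset (ZMod 4 × ZMod 4))).card := by
  decide

/-- **Atom `44` ⟹ a primitive degenerate CM type.**  If the Galois group of the abelian CM field `K` contains
`ℤ/4 × ℤ/4` as a subgroup (`j` injective) with `c₀ = (2,0)` mapping to complex conjugation, then `K` has a PRIMITIVE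
DEGENERATE CM type (balanced `(2,2,2,2)` over the fibres of the first projection of the subgroup,
  extended by subgroup induction).
[cite: Gordon1999HodgeAVSurvey, §9.4.3 (Theorem [B.140])] [cite: Shimura1998, §8.1, §8.2 Prop. 26] -/
theorem exists_isPrimitive_not_isNondegenerate_of_atom44 (hcomm : ∀ g h : K ≃ₐ[ℚ] K, g * h = h * g)
    (j : ZMod 4 × ZMod 4 →+ Additive (K ≃ₐ[ℚ] K)) (hj : Function.Injective j)
    (hc : Additive.toMul (j (2, 0)) = (IsCMField.complexConj K).restrictScalars ℚ) (φ₀ : K →+* ℂ) :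
    ∃ Φ : CMType K, IsPrimitive (ℂ ≃+* ℂ) Φ.1 φ₀ ∧ ¬ IsNondegenerate Φ :=
  exists_isPrimitive_not_isNondegenerate_of_model hcomm j hj (2, 0) hc _ _ cm₀_44 cm₁_44 prim_44 ntr_44
    (AddMonoidHom.fst (ZMod 4) (ZMod 4)) (by decide) bal₀_44 bal₁_44 φ₀

/-- **Atom `44` ⟹ a simple degenerate CM abelian variety** of dimension `[K:ℚ]/2` with an exceptional Hodge class
on some power. [cite: Shimura1998, §6.2 Thm. 3 and §8.2 Prop. 26] [cite: Gordon1999HodgeAVSurvey, §9.4.3] -/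
theorem exists_simple_degenerate_of_atom44 (hcomm : ∀ g h : K ≃ₐ[ℚ] K, g * h = h * g)
    (j : ZMod 4 × ZMod 4 →+ Additive (K ≃ₐ[ℚ] K)) (hj : Function.Injective j)
    (hc : Additive.toMul (j (2, 0)) = (IsCMField.complexConj K).restrictScalars ℚ) :
    ∃ (Φ : CMType K) (φ₀ : K →+* ℂ) (A : AbelianVariety ℂ) (ι : 𝓞 K →+* End A)
      (θ : K →+* Module.End ℂ (complexBetti A.X 1)),
      IsPrimitive (ℂ ≃+* ℂ) Φ.1 φ₀ ∧ ¬ IsNondegenerate Φ ∧ IsCMTypeRealisation Φ A ι θ ∧ A.IsSimple ∧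
      A.dim = Module.finrank ℚ K / 2 :=
  exists_simple_degenerate_of_model hcomm j hj (2, 0) hc _ _ cm₀_44 cm₁_44 prim_44 ntr_44
    (AddMonoidHom.fst (ZMod 4) (ZMod 4)) (by decide) bal₀_44 bal₁_44

end Atom44

/-! ## Atom `422`: `ℤ/4 × (ℤ/2)²`, `c₀ = (0,1,0)` -/

section Atom422

/-- Atom `422`: `ℤ/4 × (ℤ/2)²`, `c₀ = (0,1,0)` — `T₀` is a CM set. [folklore] -/
theorem cm₀_422 : ∀ x : ZMod 4 × ZMod 2 × ZMod 2, x ∈ ({(0,0,0), (0,0,1), (1,0,0), (1,1,1), (2,0,1), (2,1,0),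
  (3,1,0), (3,1,1)} : Finset (ZMod 4 × ZMod 2 × ZMod 2)) ↔
    (0, 1, 0) + x ∉ ({(0,0,0), (0,0,1), (1,0,0), (1,1,1), (2,0,1), (2,1,0), (3,1,0),
      (3,1,1)} : Finset (ZMod 4 × ZMod 2 × ZMod 2)) := by
  decide

/-- Atom `422`: the companion `T₁` is a CM set. [folklore] -/
theorem cm₁_422 : ∀ x : ZMod 4 × ZMod 2 × ZMod 2, x ∈ ({(0,0,0), (0,0,1), (1,1,0), (1,1,1), (2,0,0), (2,0,1),
  (3,1,0), (3,1,1)} : Finset (ZMod 4 × ZMod 2 × ZMod 2)) ↔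
    (0, 1, 0) + x ∉ ({(0,0,0), (0,0,1), (1,1,0), (1,1,1), (2,0,0), (2,0,1), (3,1,0),
      (3,1,1)} : Finset (ZMod 4 × ZMod 2 × ZMod 2)) := by
  decide

/-- Atom `422`: `T₀` has trivial stabiliser. [folklore] -/
theorem prim_422 : ∀ v : ZMod 4 × ZMod 2 × ZMod 2, v ≠ 0 → ∃ w : ZMod 4 × ZMod 2 × ZMod 2,
    ¬ (w ∈ ({(0,0,0), (0,0,1), (1,0,0), (1,1,1), (2,0,1), (2,1,0), (3,1,0),
      (3,1,1)} : Finset (ZMod 4 × ZMod 2 × ZMod 2)) ↔ v + w ∈ ({(0,0,0), (0,0,1), (1,0,0), (1,1,1), (2,0,1), (2,1,0),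
      (3,1,0), (3,1,1)} : Finset (ZMod 4 × ZMod 2 × ZMod 2))) := by
  decide

/-- Atom `422`: `T₀` is not a translate of `T₁`. [folklore] -/
theorem ntr_422 : ∀ d : ZMod 4 × ZMod 2 × ZMod 2, ∃ w : ZMod 4 × ZMod 2 × ZMod 2,
    ¬ (w ∈ ({(0,0,0), (0,0,1), (1,1,0), (1,1,1), (2,0,0), (2,0,1), (3,1,0),
      (3,1,1)} : Finset (ZMod 4 × ZMod 2 × ZMod 2)) ↔ d + w ∈ ({(0,0,0), (0,0,1), (1,0,0), (1,1,1), (2,0,1), (2,1,0),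
      (3,1,0), (3,1,1)} : Finset (ZMod 4 × ZMod 2 × ZMod 2))) := by
  decide

/-- Atom `422`: `T₀` is of Weil type `(4,4)` over the fibres of the middle coordinate (kernel `ℤ/4 × 0 × ℤ/2` of index `2`,
  an imaginary quadratic subfield). [folklore] -/
theorem bal₀_422 : ∀ x : ZMod 4 × ZMod 2 × ZMod 2,
    (Finset.univ.filter fun h : ZMod 4 × ZMod 2 × ZMod 2 => ((AddMonoidHom.fst (ZMod 2) (ZMod 2)).comp (AddMonoidHom.snd (ZMod 4) (ZMod 2 × ZMod 2))) h = ((AddMonoidHom.fst (ZMod 2) (ZMod 2)).comp (AddMonoidHom.snd (ZMod 4) (ZMod 2 × ZMod 2))) x ∧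
      h ∈ ({(0,0,0), (0,0,1), (1,0,0), (1,1,1), (2,0,1), (2,1,0), (3,1,0),
        (3,1,1)} : Finset (ZMod 4 × ZMod 2 × ZMod 2))).card =
    (Finset.univ.filter fun h : ZMod 4 × ZMod 2 × ZMod 2 => ((AddMonoidHom.fst (ZMod 2) (ZMod 2)).comp (AddMonoidHom.snd (ZMod 4) (ZMod 2 × ZMod 2))) h = ((AddMonoidHom.fst (ZMod 2) (ZMod 2)).comp (AddMonoidHom.snd (ZMod 4) (ZMod 2 × ZMod 2))) x ∧
      h ∉ ({(0,0,0), (0,0,1), (1,0,0), (1,1,1), (2,0,1), (2,1,0), (3,1,0),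
        (3,1,1)} : Finset (ZMod 4 × ZMod 2 × ZMod 2))).card := by
  decide

/-- Atom `422`: `T₁` is balanced over the same fibres. [folklore] -/
theorem bal₁_422 : ∀ x : ZMod 4 × ZMod 2 × ZMod 2,
    (Finset.univ.filter fun h : ZMod 4 × ZMod 2 × ZMod 2 => ((AddMonoidHom.fst (ZMod 2) (ZMod 2)).comp (AddMonoidHom.snd (ZMod 4) (ZMod 2 × ZMod 2))) h = ((AddMonoidHom.fst (ZMod 2) (ZMod 2)).comp (AddMonoidHom.snd (ZMod 4) (ZMod 2 × ZMod 2))) x ∧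
      h ∈ ({(0,0,0), (0,0,1), (1,1,0), (1,1,1), (2,0,0), (2,0,1), (3,1,0),
        (3,1,1)} : Finset (ZMod 4 × ZMod 2 × ZMod 2))).card =
    (Finset.univ.filter fun h : ZMod 4 × ZMod 2 × ZMod 2 => ((AddMonoidHom.fst (ZMod 2) (ZMod 2)).comp (AddMonoidHom.snd (ZMod 4) (ZMod 2 × ZMod 2))) h = ((AddMonoidHom.fst (ZMod 2) (ZMod 2)).comp (AddMonoidHom.snd (ZMod 4) (ZMod 2 × ZMod 2))) x ∧
      h ∉ ({(0,0,0), (0,0,1), (1,1,0), (1,1,1), (2,0,0), (2,0,1), (3,1,0),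
        (3,1,1)} : Finset (ZMod 4 × ZMod 2 × ZMod 2))).card := by
  decide

/-- **Atom `422` ⟹ a primitive degenerate CM type.**  If the Galois group of the abelian CM field `K` contains
`ℤ/4 × (ℤ/2)²` as a subgroup (`j` injective) with `c₀ = (0,1,0)` mapping to complex conjugation,
  then `K` has a PRIMITIVE
DEGENERATE CM type (of Weil type `(4,4)` over the fibres of the middle coordinate of the subgroup,
  extended by subgroup induction).
[cite: Gordon1999HodgeAVSurvey, §9.4.3 (Theorem [B.140])] [cite: Shimura1998, §8.1, §8.2 Prop. 26] -/
theorem exists_isPrimitive_not_isNondegenerate_of_atom422 (hcomm : ∀ g h : K ≃ₐ[ℚ] K, g * h = h * g)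
    (j : ZMod 4 × ZMod 2 × ZMod 2 →+ Additive (K ≃ₐ[ℚ] K)) (hj : Function.Injective j)
    (hc : Additive.toMul (j (0, 1, 0)) = (IsCMField.complexConj K).restrictScalars ℚ) (φ₀ : K →+* ℂ) :
    ∃ Φ : CMType K, IsPrimitive (ℂ ≃+* ℂ) Φ.1 φ₀ ∧ ¬ IsNondegenerate Φ :=
  exists_isPrimitive_not_isNondegenerate_of_model hcomm j hj (0, 1, 0) hc _ _ cm₀_422 cm₁_422 prim_422 ntr_422
    ((AddMonoidHom.fst (ZMod 2) (ZMod 2)).comp (AddMonoidHom.snd (ZMod 4) (ZMod 2 × ZMod 2))) (by decide) bal₀_422 bal₁_422 φ₀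

/-- **Atom `422` ⟹ a simple degenerate CM abelian variety** of dimension `[K:ℚ]/2` with an exceptional Hodge class
on some power. [cite: Shimura1998, §6.2 Thm. 3 and §8.2 Prop. 26] [cite: Gordon1999HodgeAVSurvey, §9.4.3] -/
theorem exists_simple_degenerate_of_atom422 (hcomm : ∀ g h : K ≃ₐ[ℚ] K, g * h = h * g)
    (j : ZMod 4 × ZMod 2 × ZMod 2 →+ Additive (K ≃ₐ[ℚ] K)) (hj : Function.Injective j)
    (hc : Additive.toMul (j (0, 1, 0)) = (IsCMField.complexConj K).restrictScalars ℚ) :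
    ∃ (Φ : CMType K) (φ₀ : K →+* ℂ) (A : AbelianVariety ℂ) (ι : 𝓞 K →+* End A)
      (θ : K →+* Module.End ℂ (complexBetti A.X 1)),
      IsPrimitive (ℂ ≃+* ℂ) Φ.1 φ₀ ∧ ¬ IsNondegenerate Φ ∧ IsCMTypeRealisation Φ A ι θ ∧ A.IsSimple ∧
      A.dim = Module.finrank ℚ K / 2 :=
  exists_simple_degenerate_of_model hcomm j hj (0, 1, 0) hc _ _ cm₀_422 cm₁_422 prim_422 ntr_422
    ((AddMonoidHom.fst (ZMod 2) (ZMod 2)).comp (AddMonoidHom.snd (ZMod 4) (ZMod 2 × ZMod 2))) (by decide) bal₀_422 bal₁_422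

end Atom422

/-! ## Atom `82`: `ℤ/8 × ℤ/2`, `c₀ = (0,1)` -/

section Atom82

/-- Atom `82`: `ℤ/8 × ℤ/2`, `c₀ = (0,1)` — `T₀` is a CM set. [folklore] -/
theorem cm₀_82 : ∀ x : ZMod 8 × ZMod 2, x ∈ ({(0,0), (1,0), (2,0), (3,1), (4,0), (5,1), (6,1),
  (7,1)} : Finset (ZMod 8 × ZMod 2)) ↔
    (0, 1) + x ∉ ({(0,0), (1,0), (2,0), (3,1), (4,0), (5,1), (6,1), (7,1)} : Finset (ZMod 8 × ZMod 2)) := by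
  decide

/-- Atom `82`: the companion `T₁` is a CM set. [folklore] -/
theorem cm₁_82 : ∀ x : ZMod 8 × ZMod 2, x ∈ ({(0,0), (1,1), (2,0), (3,1), (4,0), (5,1), (6,0),
  (7,1)} : Finset (ZMod 8 × ZMod 2)) ↔
    (0, 1) + x ∉ ({(0,0), (1,1), (2,0), (3,1), (4,0), (5,1), (6,0), (7,1)} : Finset (ZMod 8 × ZMod 2)) := by
  decide

/-- Atom `82`: `T₀` has trivial stabiliser. [folklore] -/
theorem prim_82 : ∀ v : ZMod 8 × ZMod 2, v ≠ 0 → ∃ w : ZMod 8 × ZMod 2,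
    ¬ (w ∈ ({(0,0), (1,0), (2,0), (3,1), (4,0), (5,1), (6,1), (7,1)} : Finset (ZMod 8 × ZMod 2)) ↔ v + w ∈ ({(0,0),
      (1,0), (2,0), (3,1), (4,0), (5,1), (6,1), (7,1)} : Finset (ZMod 8 × ZMod 2))) := by
  decide

/-- Atom `82`: `T₀` is not a translate of `T₁`. [folklore] -/
theorem ntr_82 : ∀ d : ZMod 8 × ZMod 2, ∃ w : ZMod 8 × ZMod 2,
    ¬ (w ∈ ({(0,0), (1,1), (2,0), (3,1), (4,0), (5,1), (6,0), (7,1)} : Finset (ZMod 8 × ZMod 2)) ↔ d + w ∈ ({(0,0),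
      (1,0), (2,0), (3,1), (4,0), (5,1), (6,1), (7,1)} : Finset (ZMod 8 × ZMod 2))) := by
  decide

/-- Atom `82`: `T₀` is of Weil type `(4,4)` over the fibres of the second projection (kernel `ℤ/8 × 0` of index `2`,
  an imaginary quadratic subfield; `{0,1,2,4} ⊂ ℤ/8` is not a translate of itself or of its complement). [folklore] -/
theorem bal₀_82 : ∀ x : ZMod 8 × ZMod 2,
    (Finset.univ.filter fun h : ZMod 8 × ZMod 2 => (AddMonoidHom.snd (ZMod 8) (ZMod 2)) h = (AddMonoidHom.snd (ZMod 8) (ZMod 2)) x ∧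
      h ∈ ({(0,0), (1,0), (2,0), (3,1), (4,0), (5,1), (6,1), (7,1)} : Finset (ZMod 8 × ZMod 2))).card =
    (Finset.univ.filter fun h : ZMod 8 × ZMod 2 => (AddMonoidHom.snd (ZMod 8) (ZMod 2)) h = (AddMonoidHom.snd (ZMod 8) (ZMod 2)) x ∧
      h ∉ ({(0,0), (1,0), (2,0), (3,1), (4,0), (5,1), (6,1), (7,1)} : Finset (ZMod 8 × ZMod 2))).card := by
  decide

/-- Atom `82`: `T₁` is balanced over the same fibres. [folklore] -/
theorem bal₁_82 : ∀ x : ZMod 8 × ZMod 2,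
    (Finset.univ.filter fun h : ZMod 8 × ZMod 2 => (AddMonoidHom.snd (ZMod 8) (ZMod 2)) h = (AddMonoidHom.snd (ZMod 8) (ZMod 2)) x ∧
      h ∈ ({(0,0), (1,1), (2,0), (3,1), (4,0), (5,1), (6,0), (7,1)} : Finset (ZMod 8 × ZMod 2))).card =
    (Finset.univ.filter fun h : ZMod 8 × ZMod 2 => (AddMonoidHom.snd (ZMod 8) (ZMod 2)) h = (AddMonoidHom.snd (ZMod 8) (ZMod 2)) x ∧
      h ∉ ({(0,0), (1,1), (2,0), (3,1), (4,0), (5,1), (6,0), (7,1)} : Finset (ZMod 8 × ZMod 2))).card := by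
  decide

/-- **Atom `82` ⟹ a primitive degenerate CM type.**  If the Galois group of the abelian CM field `K` contains
`ℤ/8 × ℤ/2` as a subgroup (`j` injective) with `c₀ = (0,1)` mapping to complex conjugation, then `K` has a PRIMITIVE
DEGENERATE CM type (of Weil type `(4,4)` over the fibres of the second projection of the subgroup,
  extended by subgroup induction).
[cite: Gordon1999HodgeAVSurvey, §9.4.3 (Theorem [B.140])] [cite: Shimura1998, §8.1, §8.2 Prop. 26] -/
theorem exists_isPrimitive_not_isNondegenerate_of_atom82 (hcomm : ∀ g h : K ≃ₐ[ℚ] K, g * h = h * g)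
    (j : ZMod 8 × ZMod 2 →+ Additive (K ≃ₐ[ℚ] K)) (hj : Function.Injective j)
    (hc : Additive.toMul (j (0, 1)) = (IsCMField.complexConj K).restrictScalars ℚ) (φ₀ : K →+* ℂ) :
    ∃ Φ : CMType K, IsPrimitive (ℂ ≃+* ℂ) Φ.1 φ₀ ∧ ¬ IsNondegenerate Φ :=
  exists_isPrimitive_not_isNondegenerate_of_model hcomm j hj (0, 1) hc _ _ cm₀_82 cm₁_82 prim_82 ntr_82
    (AddMonoidHom.snd (ZMod 8) (ZMod 2)) (by decide) bal₀_82 bal₁_82 φ₀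

/-- **Atom `82` ⟹ a simple degenerate CM abelian variety** of dimension `[K:ℚ]/2` with an exceptional Hodge class
on some power. [cite: Shimura1998, §6.2 Thm. 3 and §8.2 Prop. 26] [cite: Gordon1999HodgeAVSurvey, §9.4.3] -/
theorem exists_simple_degenerate_of_atom82 (hcomm : ∀ g h : K ≃ₐ[ℚ] K, g * h = h * g)
    (j : ZMod 8 × ZMod 2 →+ Additive (K ≃ₐ[ℚ] K)) (hj : Function.Injective j)
    (hc : Additive.toMul (j (0, 1)) = (IsCMField.complexConj K).restrictScalars ℚ) :
    ∃ (Φ : CMType K) (φ₀ : K →+* ℂ) (A : AbelianVariety ℂ) (ι : 𝓞 K →+* End A)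
      (θ : K →+* Module.End ℂ (complexBetti A.X 1)),
      IsPrimitive (ℂ ≃+* ℂ) Φ.1 φ₀ ∧ ¬ IsNondegenerate Φ ∧ IsCMTypeRealisation Φ A ι θ ∧ A.IsSimple ∧
      A.dim = Module.finrank ℚ K / 2 :=
  exists_simple_degenerate_of_model hcomm j hj (0, 1) hc _ _ cm₀_82 cm₁_82 prim_82 ntr_82
    (AddMonoidHom.snd (ZMod 8) (ZMod 2)) (by decide) bal₀_82 bal₁_82

end Atom82

end Summit.HodgeConjecture.CorCM.TwoPowerAtoms

end
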